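import Summits.ABC.StewartYu.ArchG3RecLinesCK
import Summits.ABC.StewartYu.ArchG3RecU0
import Summits.ABC.StewartYu.ArchG3PackClosedV
import HarnessLib

/-!
# The archimedean record `ArchG3Rec` — the k-step families of `LinesClosedK κ c`, file 1/3: COINS
# (cell abc-stewartyu, crux r2 `ArchCoreRat` stmt-ABC-20502, line `arch-g3-frame`, seam (B) of `stub_recLinesArch`; plan R50/R50′, seat p4 g10)

Support file (theorems only; no named facts, no definitions).  The small letters of the record against the unit `Z = G·X·L`
(all from p1 g11's ✓ atoms `Z_floors`, `X_floors`, `L_real`, `T_facts`, `Xs_le_dbl`, `Xs_cap_facts`, `Nf_real`, `L_floors`,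
`log_letters_le`, `Omega_le_L_WN`, `WN_bounds` and ✓ `two_pow_le_CbK`):

* `kj_units`, `kj_units2`, `kj_LWN`: `L ≤ Z/(512(n+1)²)`, `L·WN ≤ Z/(64(n+1))`, `X·L ≤ Z/8`, `WN ≤ Z/2^{n+31}`, `X ≤ Z/2^{n+28}`,
  `1 ≤ Z/2^{n+34}`, `Ω ≤ Z/2^{n+29}`, `n + 16 ≤ Z/2^29`, `n·Z ≤ 2ⁿ·Z`, `2ⁿ ≤ Z/2^34`, `(n+10)·L ≤ Z/40`, `(32n+48)·L ≤ Z/8`, …;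
* `kj_T`: `1 ≤ T s ≤ 8L`, `T s ≤ 8L/2^s + 1`, `T s·s ≤ 8L + s`; `kj_nodes`: BOTH caps of `Xs` — `Xs lev ≤ 2^lev·X`,
  `Nf lev ν ≤ 2^{ν+lev}·X`, `Nf lev ν·(T lev + 1) ≤ 2^ν·(4XL + T lev + 1)`; `kj_Sd`: `Ŝ, lev ≤ L/4`;
* `kj_γb`: `0 ≤ wl lev ≤ L/2^lev`, `0 ≤ γb lev ≤ (n/2+1)·L/2^lev`; `kj_logs`: `log N ≤ WN`, `log L ≤ L/2^21`, `log X ≤ X`,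
  `log κ ≤ n` (`1 ≤ κ ≤ 2ⁿ`), `log n ≤ n`.

Files 2/3 (`ArchG3RecLinesKPieces`) and 3/3 (`ArchG3RecLinesKJC`) bound the pieces of the (J)/(C) lines and assemble them.

## References
* [Nesterenko2003] Yu. V. Nesterenko, LNM 1819 (2003) — §3.5 (3.23)–(3.25); §4 (4.3)–(4.5).
* [Matveev2000] E. M. Matveev, Izv. Math. 64 (2000), §3 (the slab weights `γb`, `wl`).
-/

noncomputable section

open Finset Real
open scoped Nat
open Summit.ABC.StewartYu.ArchSupply (WC)
open Summit.ABC.StewartYu.ArchG3Setup (DΔC)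

namespace Summit.ABC.StewartYu

namespace ArchG3Rec

open PadicG3Par (Cb Cb_pos)
open ArchG3Par (G K yloadK G_eq G_pos K_pos yloadK_pos eight_le_G)

variable {n : ℕ} (P : ArchG3Rec n)

/-! ### The unit `Z` against the small letters -/

/-- **coins**: `0 < Z`, `L ≤ Z/(512(n+1)²)`, `L·WN ≤ Z/(64(n+1))`, `X·L ≤ Z/8`, `WN ≤ Z/2^{n+31}`, `X ≤ Z/2^{n+28}`, `1 ≤ Z/2^{n+34}`,
`Ω ≤ Z/2^{n+29}`. [folklore] -/
theorem kj_units : 0 < P.Z ∧ (P.L : ℝ) ≤ P.Z / (512 * ((n : ℝ) + 1) ^ 2) ∧ (P.L : ℝ) * P.WN ≤ P.Z / (64 * ((n : ℝ) + 1)) ∧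
    (P.X : ℝ) * P.L ≤ P.Z / 8 ∧ P.WN ≤ P.Z / 2 ^ (n + 31) ∧ (P.X : ℝ) ≤ P.Z / 2 ^ (n + 28) ∧ (1 : ℝ) ≤ P.Z / 2 ^ (n + 34) ∧
    P.Ω ≤ P.Z / 2 ^ (n + 29) := by
  obtain ⟨hZ0, h64, h512, hXL⟩ := P.Z_floors
  obtain ⟨hL1, hL0, hL25, -⟩ := P.L_real
  obtain ⟨hWN1, -, -, hWN0⟩ := P.WN_bounds
  have hG := eight_le_G n
  have hG0 := G_pos n
  have hn0 : (0 : ℝ) ≤ n := Nat.cast_nonneg n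
  have hX0 : (0 : ℝ) ≤ P.X := Nat.cast_nonneg _
  have hΩ := P.Omega_le_L_WN
  have hCbK := two_pow_le_CbK (n := n) P.hn
  have h2 : (P.L : ℝ) ≤ P.Z / (512 * ((n : ℝ) + 1) ^ 2) := by
    rw [le_div_iff₀ (by positivity)]; linarith
  have h3 : (P.L : ℝ) * P.WN ≤ P.Z / (64 * ((n : ℝ) + 1)) := by
    rw [le_div_iff₀ (by positivity)]; linarith
  have h4 : (P.X : ℝ) * P.L ≤ P.Z / 8 := by
    rw [hXL, div_le_div_iff_of_pos_left hZ0 hG0 (by norm_num)]; exact hG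
  have h5 : P.WN ≤ P.Z / 2 ^ (n + 31) := by
    rw [le_div_iff₀ (by positivity)]
    have e : (2 : ℝ) ^ (n + 31) = 64 * 2 ^ (n + 25) := by rw [show n + 31 = (n + 25) + 6 by omega, pow_add]; ring
    have h1 : P.WN * 2 ^ (n + 25) ≤ P.WN * P.L := mul_le_mul_of_nonneg_left hL25 hWN0.le
    have h1' : P.WN * P.L ≤ ((n : ℝ) + 1) * P.L * P.WN := by
      have := mul_nonneg hn0 (mul_nonneg hL0.le hWN0.le); nlinarith
    rw [e]; nlinarith
  have h6 : (P.X : ℝ) ≤ P.Z / 2 ^ (n + 28) := by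
    rw [le_div_iff₀ (by positivity)]
    have e : (2 : ℝ) ^ (n + 28) = 8 * 2 ^ (n + 25) := by rw [show n + 28 = (n + 25) + 3 by omega, pow_add]; ring
    rw [e]
    have := mul_le_mul_of_nonneg_left hL25 hX0
    have h4' : 8 * ((P.X : ℝ) * P.L) ≤ P.Z := by rw [le_div_iff₀ (by norm_num)] at h4; linarith
    nlinarith
  have h7 : (1 : ℝ) ≤ P.Z / 2 ^ (n + 34) := by
    rw [le_div_iff₀ (by positivity)]
    have e : (2 : ℝ) ^ (n + 34) = 512 * 2 ^ (n + 25) := by rw [show n + 34 = (n + 25) + 9 by omega, pow_add]; ring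
    have hn1 : (1 : ℝ) ≤ ((n : ℝ) + 1) ^ 2 := by nlinarith
    have : 512 * (P.L : ℝ) ≤ 512 * ((n : ℝ) + 1) ^ 2 * P.L := by nlinarith
    rw [one_mul, e]; linarith
  have h8 : P.Ω ≤ P.Z / 2 ^ (n + 29) := by
    rw [le_div_iff₀ (by positivity)]
    -- `48·C_bⁿK·Ω ≤ L·WN ≤ Z/(64(n+1)) ≤ Z/64`, `C_bⁿK ≥ 2^{n+18}`
    have h9 : (P.L : ℝ) * P.WN ≤ P.Z / 64 := by
      refine h3.trans (div_le_div_of_nonneg_left hZ0.le (by norm_num) ?_); nlinarith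
    have hΩ0 := P.Ω_facts.1
    have h10 : 2 ^ (n + 18) * P.Ω ≤ Cb ^ n * K n * P.Ω := mul_le_mul_of_nonneg_right hCbK hΩ0.le
    have e : (2 : ℝ) ^ (n + 29) = 2 ^ 11 * 2 ^ (n + 18) := by rw [← pow_add]; ring_nf
    rw [e]
    have h11 : (P.L : ℝ) * P.WN * 64 ≤ P.Z := by rwa [le_div_iff₀ (by norm_num)] at h9
    nlinarith
  exact ⟨hZ0, h2, h3, h4, h5, h6, h7, h8⟩

/-- the order drop as a real: `1 ≤ T s ≤ 8L`, `T s ≤ 8L/2^s + 1`, `T s·s ≤ 8L + s`. [folklore] -/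
theorem kj_T (s : ℕ) : (1 : ℝ) ≤ P.T s ∧ (P.T s : ℝ) ≤ 8 * P.L ∧ (P.T s : ℝ) ≤ 8 * P.L / 2 ^ s + 1 ∧
    (P.T s : ℝ) * s ≤ 8 * P.L + s := by
  obtain ⟨h1, h8, -⟩ := P.T_facts s
  have h1' : (1 : ℝ) ≤ P.T s := by exact_mod_cast h1
  have h8' : (P.T s : ℝ) ≤ 8 * P.L := by exact_mod_cast h8
  have hL : (0 : ℝ) ≤ P.L := Nat.cast_nonneg _
  have h3 : (P.T s : ℝ) ≤ 8 * P.L / 2 ^ s + 1 := by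
    unfold T
    rcases le_total 1 (8 * P.L / 2 ^ s) with h | h
    · rw [max_eq_right h]
      have := Nat.cast_div_le (m := 8 * P.L) (n := 2 ^ s) (α := ℝ)
      push_cast at this; linarith
    · rw [max_eq_left h]; push_cast
      have : (0 : ℝ) ≤ 8 * (P.L : ℝ) / 2 ^ s := by positivity
      linarith
  refine ⟨h1', h8', h3, ?_⟩
  have hs : (s : ℝ) ≤ 2 ^ s := by exact_mod_cast Nat.lt_two_pow_self.le
  have hs0 : (0 : ℝ) ≤ s := Nat.cast_nonneg s
  have h2s : (0 : ℝ) < 2 ^ s := by positivity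
  have h4 : 8 * (P.L : ℝ) / 2 ^ s * s ≤ 8 * P.L := by
    rw [div_mul_eq_mul_div, div_le_iff₀ h2s]; nlinarith
  nlinarith [mul_le_mul_of_nonneg_right h3 hs0]

/-- **node counts** (both caps of `Xs`): `1 ≤ Xs lev ≤ 2^lev·X`, `1 ≤ Nf lev ν ≤ 2^{ν+lev}·X`, `Nf lev ν·(T lev + 1) ≤ 2^ν·(4XL + T lev + 1)`.
[cite: Nesterenko2003, (4.3)] -/
theorem kj_nodes (lev ν : ℕ) : (1 : ℝ) ≤ P.Xs lev ∧ (P.Xs lev : ℝ) ≤ 2 ^ lev * P.X ∧ (1 : ℝ) ≤ P.Nf lev ν ∧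
    (P.Nf lev ν : ℝ) ≤ 2 ^ (ν + lev) * P.X ∧ (P.Nf lev ν : ℝ) * (P.T lev + 1) ≤ 2 ^ ν * (4 * P.X * P.L + P.T lev + 1) := by
  obtain ⟨hX1, hcap⟩ := P.Xs_cap_facts lev
  have hd := P.Xs_le_dbl lev
  have hX := P.X_floors.2.1
  obtain ⟨hNf, -⟩ := P.Nf_real lev ν
  have hX1' : (1 : ℝ) ≤ P.Xs lev := by exact_mod_cast hX1
  have h2l : (1 : ℝ) ≤ 2 ^ lev := one_le_pow₀ (by norm_num)
  have h2ν : (1 : ℝ) ≤ 2 ^ ν := one_le_pow₀ (by norm_num)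
  have h1 : (P.Xs lev : ℝ) ≤ 2 ^ lev * P.X := by nlinarith
  have hT0 : (0 : ℝ) < P.T lev + 1 := by positivity
  have h3 : (P.Xs lev : ℝ) ≤ 4 * P.X * P.L / (P.T lev + 1) + 1 := by
    have := Nat.cast_div_le (m := 4 * P.X * P.L) (n := P.T lev + 1) (α := ℝ)
    have h' : ((P.Xs lev : ℕ) : ℝ) ≤ ((4 * P.X * P.L / (P.T lev + 1) + 1 : ℕ) : ℝ) := by exact_mod_cast hcap
    push_cast at this h'; linarith
  have h4 : (P.Xs lev : ℝ) * (P.T lev + 1) ≤ 4 * P.X * P.L + P.T lev + 1 := by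
    have := mul_le_mul_of_nonneg_right h3 hT0.le
    rwa [add_mul, div_mul_cancel₀ _ hT0.ne', one_mul, ← add_assoc] at this
  refine ⟨hX1', h1, by rw [hNf]; nlinarith, ?_, ?_⟩
  · rw [hNf, pow_add]; nlinarith
  · rw [hNf, mul_assoc]
    exact mul_le_mul_of_nonneg_left h4 (by positivity)

/-- `Ŝ ≤ L/4` and `lev ≤ L/4` for `lev ≤ Ŝ` (real; `4(Ŝ+2) ≤ L`). [folklore] -/
theorem kj_Sd {lev : ℕ} (hlev : lev ≤ P.Sd) : (P.Sd : ℝ) ≤ P.L / 4 ∧ (lev : ℝ) ≤ P.L / 4 := by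
  have h := P.L_floors.2.2
  have h1 : ((4 * (P.Sd + 2) : ℕ) : ℝ) ≤ P.L := by exact_mod_cast h
  push_cast at h1
  have h2 : (lev : ℝ) ≤ P.Sd := by exact_mod_cast hlev
  constructor <;> linarith

/-- the slab letters: `0 ≤ wl lev ≤ L/2^lev`, `0 ≤ γb lev ≤ (n/2 + 1)·L/2^lev`. [cite: Matveev2000, §3; shape only] -/
theorem kj_γb (lev : ℕ) : 0 ≤ P.wl lev ∧ P.wl lev ≤ P.L / 2 ^ lev ∧ 0 ≤ P.γb lev ∧ P.γb lev ≤ ((n : ℝ) / 2 + 1) * P.L / 2 ^ lev := by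
  have hL : (0 : ℝ) ≤ P.L := Nat.cast_nonneg _
  have hn0 : (0 : ℝ) ≤ n := Nat.cast_nonneg n
  have hwl : ∀ s, 0 ≤ P.wl s ∧ P.wl s ≤ P.L / 2 ^ s := fun s => by
    unfold wl
    have he : Real.exp (-(G n + 2)) ≤ 1 := Real.exp_le_one_iff.mpr (by linarith [G_pos n])
    have he0 := Real.exp_pos (-(G n + 2))
    refine ⟨by positivity, div_le_div_of_nonneg_right (by nlinarith) (by positivity)⟩
  obtain ⟨hw0, hw⟩ := hwl lev
  refine ⟨hw0, hw, ?_, ?_⟩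
  · cases lev with
    | zero => simp only [γb]; have := (hwl 0).1; positivity
    | succ s => simp only [γb]; have := (hwl s).1; positivity
  · cases lev with
    | zero =>
        simp only [γb, pow_zero, div_one]
        have := (hwl 0).2; simp only [pow_zero, div_one] at this; nlinarith
    | succ s =>
        simp only [γb]
        have h1 := (hwl s).2
        have h2 : P.wl s / 2 ≤ P.L / 2 ^ (s + 1) := by
          rw [pow_succ, ← div_div]; exact div_le_div_of_nonneg_right h1 (by norm_num)
        have h3 : (P.L : ℝ) / 2 ^ (s + 1) ≤ ((n : ℝ) / 2 + 1) * P.L / 2 ^ (s + 1) :=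
          div_le_div_of_nonneg_right (by nlinarith) (by positivity)
        linarith

/-- the small logs: `log N ≤ WN`, `log L ≤ L/2^21`, `log X ≤ X`, `log κ ≤ n` (for `1 ≤ κ ≤ 2ⁿ`), `log n ≤ n`, all `≥ 0`. [folklore] -/
theorem kj_logs (κ : ℕ) (hκ : 1 ≤ κ) (hκ2 : (κ : ℝ) ≤ 2 ^ n) : Real.log P.N ≤ P.WN ∧ Real.log P.L ≤ (P.L : ℝ) / 2 ^ 21 ∧
    Real.log P.X ≤ (P.X : ℝ) ∧ Real.log κ ≤ n ∧ Real.log n ≤ n ∧ 0 ≤ Real.log (P.L : ℝ) ∧ 0 ≤ Real.log (P.X : ℝ) ∧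
    0 ≤ Real.log (P.N : ℝ) ∧ 0 ≤ Real.log (κ : ℝ) := by
  obtain ⟨hL, hX, hN, hL0, hX0⟩ := P.log_letters_le
  have hκ1 : (1 : ℝ) ≤ κ := by exact_mod_cast hκ
  have hlκ : Real.log κ ≤ n := by
    calc Real.log κ ≤ Real.log (2 ^ n) := Real.log_le_log (by linarith) hκ2
      _ = n * Real.log 2 := by rw [Real.log_pow]
      _ ≤ n := by have := Real.log_two_lt_d9; have hn : (0:ℝ) ≤ n := Nat.cast_nonneg n; nlinarith
  have hln : Real.log n ≤ n := by
    rcases Nat.eq_zero_or_pos n with h | h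
    · simp [h]
    · have : (0 : ℝ) < n := by exact_mod_cast h
      linarith [Real.log_le_sub_one_of_pos this]
  exact ⟨hN, hL, hX, hlκ, hln, hL0, hX0, P.N_facts.2.2, Real.log_nonneg hκ1⟩


/-- more coins (the exponent `n` dropped, `n ≤ 2ⁿ`): `n + 16 ≤ Z/2^29`, `n·Z ≤ 2ⁿ·Z`, `2Z ≤ 2ⁿZ`, `2ⁿ ≤ Z/2^34`, `L ≤ Z/512`,
`(n+10)·L ≤ Z/40`, `X ≤ Z/2^28`, `WN ≤ Z/2^31`, `Ω ≤ Z/2^29`. [folklore] -/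
theorem kj_units2 : (n : ℝ) + 16 ≤ P.Z / 2 ^ 29 ∧ (n : ℝ) * P.Z ≤ 2 ^ n * P.Z ∧ 2 * P.Z ≤ 2 ^ n * P.Z ∧
    (2 : ℝ) ^ n ≤ P.Z / 2 ^ 34 ∧ (P.L : ℝ) ≤ P.Z / 512 ∧ ((n : ℝ) + 10) * P.L ≤ P.Z / 40 ∧ (P.X : ℝ) ≤ P.Z / 2 ^ 28 ∧
    P.WN ≤ P.Z / 2 ^ 31 ∧ P.Ω ≤ P.Z / 2 ^ 29 := by
  obtain ⟨hZ0, hLZ, -, -, hWN, hX, h1, hΩ⟩ := P.kj_units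
  obtain ⟨-, -, h512, -⟩ := P.Z_floors
  have hL0 : (0 : ℝ) ≤ P.L := Nat.cast_nonneg _
  have hn0 : (0 : ℝ) ≤ n := Nat.cast_nonneg n
  have hn1 : (1 : ℝ) ≤ n := by exact_mod_cast P.hn
  have hn2n : (n : ℝ) ≤ 2 ^ n := by exact_mod_cast Nat.lt_two_pow_self.le
  have h2n : (2 : ℝ) ≤ 2 ^ n := by
    calc (2 : ℝ) = 2 ^ 1 := by norm_num
      _ ≤ 2 ^ n := pow_le_pow_right₀ (by norm_num) P.hn
  have hmono : ∀ {a b : ℕ}, b ≤ a → P.Z / 2 ^ a ≤ P.Z / 2 ^ b := fun h =>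
    div_le_div_of_nonneg_left hZ0.le (by positivity) (pow_le_pow_right₀ (by norm_num) h)
  refine ⟨?_, mul_le_mul_of_nonneg_right hn2n hZ0.le, mul_le_mul_of_nonneg_right h2n hZ0.le, ?_,
    hLZ.trans ?_, ?_, hX.trans (hmono (by omega)), hWN.trans (hmono (by omega)), hΩ.trans (hmono (by omega))⟩
  · -- `n + 16 ≤ 2^{n+5} ≤ Z/2^{n+34}·2^{n+5}`
    have h1n : (1 : ℝ) ≤ 2 ^ n := one_le_pow₀ (by norm_num)
    have h2 : (n : ℝ) + 16 ≤ 2 ^ (n + 5) := by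
      have e : (2 : ℝ) ^ (n + 5) = 2 ^ n * 32 := by rw [pow_add]; norm_num
      rw [e]; linarith
    have h3 : (2 : ℝ) ^ (n + 5) ≤ P.Z / 2 ^ 29 := by
      rw [le_div_iff₀ (by positivity)]
      rw [le_div_iff₀ (by positivity), one_mul] at h1
      calc (2 : ℝ) ^ (n + 5) * 2 ^ 29 = 2 ^ (n + 34) := by rw [← pow_add]
        _ ≤ P.Z := h1
    linarith
  · rw [le_div_iff₀ (by positivity)]
    rw [le_div_iff₀ (by positivity), one_mul] at h1
    calc (2 : ℝ) ^ n * 2 ^ 34 = 2 ^ (n + 34) := by rw [← pow_add]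
      _ ≤ P.Z := h1
  · exact div_le_div_of_nonneg_left hZ0.le (by norm_num) (by nlinarith)
  · rw [le_div_iff₀ (by norm_num)]
    nlinarith [mul_nonneg hL0 (show (0 : ℝ) ≤ 512 * ((n : ℝ) + 1) ^ 2 - 40 * ((n : ℝ) + 10) by nlinarith)]

/-- `L·WN ≤ Z/64`, `(n+1)·L·WN ≤ Z/64`, `(32n+48)·L ≤ Z/8`. [folklore] -/
theorem kj_LWN : (P.L : ℝ) * P.WN ≤ P.Z / 64 ∧ ((n : ℝ) + 1) * P.L * P.WN ≤ P.Z / 64 ∧ (32 * (n : ℝ) + 48) * P.L ≤ P.Z / 8 := by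
  obtain ⟨-, h64, h512, -⟩ := P.Z_floors
  have hL0 : (0 : ℝ) ≤ P.L := Nat.cast_nonneg _
  have hWN0 := P.WN_bounds.2.2.2
  have hn0 : (0 : ℝ) ≤ n := Nat.cast_nonneg n
  have hp : 0 ≤ (n : ℝ) * (P.L * P.WN) := mul_nonneg hn0 (mul_nonneg hL0 hWN0.le)
  refine ⟨?_, ?_, ?_⟩
  · rw [le_div_iff₀ (by norm_num)]; nlinarith
  · rw [le_div_iff₀ (by norm_num)]; nlinarith
  · rw [le_div_iff₀ (by norm_num)]
    nlinarith [mul_nonneg hL0 (show (0 : ℝ) ≤ 512 * ((n : ℝ) + 1) ^ 2 - 8 * (32 * (n : ℝ) + 48) by nlinarith)]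

end ArchG3Rec

end Summit.ABC.StewartYu

end
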